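import Summits.PneNP.PneNP.Theorems.ChebyshevTracialDesignJuntaVirtualForm
import Summits.PneNP.PneNP.Theorems.ChebyshevTracialDesignJuntaVirtualPositivity
import Literature.Combinatorics.AssociationSchemes.JohnsonHarmonics
import HarnessLib

/-!
# Cell pnp-psdrank, route `ChebyshevTracialDesign`: an exact design prices every low-degree test function at Grigoriev's
# virtual level (r = 1, arbitrary set of matchings)

Harmonic backbone of the crux `TracialDecayExp20` (stmt-PneNP-19878), brick 14 — the LOW half of the degree-truncation identity for
the r = 1 rung (MEMO-8 §4). Let `(n, t, T, D, B, C, w)` be an exact design (`IsExactDesign`: `Σ_c w_c p(c) = −p(0)` for every real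
polynomial of degree `≤ D`), `q` a coefficient vector supported on sets of size `≤ D` and `f = zeta q` the multilinear polynomial
`f(U) = Σ_{A ⊆ U} q_A` of `x`-degree `≤ D` on the cuts. Then for EVERY set `Y` of perfect matchings

  `Σ_{U} Σ_{M ∈ Y} levelWeight(U,M) · f(U) = −(1/|PM_n|) · Σ_{M ∈ Y} Ẽ_M[f]`,   `Ẽ_M[f] = Σ_{|A| ≤ D} q_A · knapsackMoment(n/2, t/2, |M[A]|)`

(`lowDegree_rectangle_value_eq`): the design value of `f ⊗ 1_Y` is minus the `Y`-sum of Grigoriev's knapsack pseudo-expectation of `f`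
around `M` (`M[A]` = the edges of `M` meeting `A`; `knapsackMoment N r x = Π_{j<x}(r−j)/(N−j)`, the tree's Grigoriev 2001 vocabulary). No
tightness, no sign and no positivity hypothesis on `q` or `Y`. Ingredients: the per-matching level sums of containment events are
`T(n/2; c, i)·P_M(c)` with `deg P_M ≤ D` and `P_M(0) = Ẽ_M[f]` (`…Junta.containment_comb_poly`, p415598/p416123), `|Q_c| = |PM|·T(n/2; c, i)`,
and exactness. With the layer decomposition `1_X = f_low + f_high` of a family of cuts (lit `JohnsonSpectrum.lowPart_apply_eq_zeta`) this is the
main term of the value of the rectangle `X × Y`; the high part is controlled by bricks 12–13 (`…LevelAttenuation`, `…LevelTail`) through lit's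
`sum_sq_gram_highPart_le`. [cite: Rothvoss2017, §2 (PDF p. 6)] [cite: Grigoriev2001, Lemma 1.4 (PDF p. 8)]
Stature: support/instrument. WHAT THIS IS NOT: not virtual positivity (the sign of `Σ_{M∈Y} Ẽ_M[f_low]` for truncated indicators is the open
heart), nothing on psd rank, no P-vs-NP content. Supports stmt-PneNP-19878.
-/

set_option linter.dupNamespace false -- `Summit.PneNP.PneNP.…`: summit = sub-problem (D-0017)

noncomputable section

namespace Summit.PneNP.PneNP.Theorems.ChebyshevTracialDesignLowDegreePricing

open Finset Matrix Literature.Barriers.PneNP Literature.Combinatorics.SimpleGraph.CycleSpace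
open Literature.Combinatorics.Optimization Literature.Computability.Complexity
open Literature.Combinatorics.AssociationSchemes.JohnsonHarmonics
open Summit.PneNP.PneNP.Theorems.ChebyshevTracialDesignJunta

variable {n : ℕ}

/-- A multilinear polynomial with coefficients supported on sets of size `≤ D`, as a combination of containment events indexed by
the finite type `{A // |A| ≤ D}`: `zeta q (U) = Σ_{|A| ≤ D} q_A · 1[A ⊆ U]`. -/
theorem zeta_eq_sum_subtype {D : ℕ} (q : Finset (Fin n) → ℝ) (hq : ∀ A : Finset (Fin n), D < A.card → q A = 0)
    (U : Finset (Fin n)) :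
    zeta q U = ∑ A : {A : Finset (Fin n) // A.card ≤ D}, q A.1 * (if A.1 ⊆ U then (1 : ℝ) else 0) := by
  classical
  rw [zeta_apply]
  -- extend the sum over `U.powerset` to all sets of size `≤ D` (the others contribute `0`)
  have h1 : ∑ T ∈ U.powerset, q T = ∑ T ∈ (univ : Finset (Finset (Fin n))).filter (fun A => A.card ≤ D),
      q T * (if T ⊆ U then (1 : ℝ) else 0) := by
    rw [← sum_filter_add_sum_filter_not U.powerset (fun A => A.card ≤ D)]
    have hz : ∑ T ∈ U.powerset.filter (fun A => ¬ A.card ≤ D), q T = 0 :=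
      sum_eq_zero fun T hT => hq T (by have := (mem_filter.1 hT).2; omega)
    rw [hz, add_zero]
    symm
    rw [← sum_filter_add_sum_filter_not ((univ : Finset (Finset (Fin n))).filter (fun A => A.card ≤ D)) (fun A => A ⊆ U)]
    have hz' : ∑ T ∈ ((univ : Finset (Finset (Fin n))).filter (fun A => A.card ≤ D)).filter (fun A => ¬ A ⊆ U),
        q T * (if T ⊆ U then (1 : ℝ) else 0) = 0 :=
      sum_eq_zero fun T hT => by rw [if_neg (mem_filter.1 hT).2, mul_zero]
    rw [hz', add_zero]
    have hset : ((univ : Finset (Finset (Fin n))).filter (fun A => A.card ≤ D)).filter (fun A => A ⊆ U) =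
        U.powerset.filter (fun A => A.card ≤ D) := by
      ext T; simp only [mem_filter, mem_univ, true_and, mem_powerset]; tauto
    rw [hset]
    exact sum_congr rfl fun T hT => by rw [if_pos (mem_powerset.1 (mem_filter.1 hT).1), mul_one]
  rw [h1]
  exact sum_subtype _ (fun A => by simp) (fun A => q A * (if A ⊆ U then (1 : ℝ) else 0))

/-- **An exact design prices every low-degree test function at the virtual level, against any set of matchings.** For an exact
design `(n, t, T, D, B, C, w)`, a coefficient vector `q` supported on sets of size `≤ D` and any `Y ⊆ PM_n`:
`Σ_U Σ_{M ∈ Y} levelWeight(U,M)·zeta q (U) = −(1/|PM_n|)·Σ_{M ∈ Y} Σ_{|A| ≤ D} q_A · knapsackMoment(|M|, t/2, |M[A]|)`.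
[cite: Rothvoss2017, §2 (PDF p. 6)] [cite: Grigoriev2001, Lemma 1.4 (PDF p. 8)] -/
theorem lowDegree_rectangle_value_eq {t T D : ℕ} {Bv : ℝ} {C : Finset ℕ} {w : ℕ → ℝ} (hdes : IsExactDesign n t T D Bv C w)
    (q : Finset (Fin n) → ℝ) (hq : ∀ A : Finset (Fin n), D < A.card → q A = 0) (Y : Finset (PMatch n)) :
    ∑ U : OddSet n, ∑ M ∈ Y, levelWeight n t C w U M * zeta q U.1 =
      -((Fintype.card (PMatch n) : ℝ)⁻¹ *
        ∑ M ∈ Y, ∑ A : {A : Finset (Fin n) // A.card ≤ D},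
          q A.1 * knapsackMoment M.1.card ((t : ℝ) / 2) (M.1.filter fun e => ∃ a ∈ A.1, a ∈ e).card) := by
  classical
  obtain ⟨htodd, htn, hTt, hC, -, hexact, -⟩ := hdes
  -- Step 1: the value as level sums
  have hval : ∑ U : OddSet n, ∑ M ∈ Y, levelWeight n t C w U M * zeta q U.1 =
      ∑ c ∈ C, w c / ((Qset n t c).card : ℝ) *
        ∑ M ∈ Y, ∑ U : OddSet n, (if U.1.card = t ∧ cc U M = c then zeta q U.1 else 0) := by
    calc ∑ U : OddSet n, ∑ M ∈ Y, levelWeight n t C w U M * zeta q U.1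
        = ∑ U : OddSet n, ∑ M ∈ Y, ∑ c ∈ C, (if (U, M) ∈ Qset n t c then
            w c / ((Qset n t c).card : ℝ) * zeta q U.1 else 0) := by
          refine sum_congr rfl fun U _ => sum_congr rfl fun M _ => ?_
          rw [levelWeight, sum_mul]
          exact sum_congr rfl fun c _ => by split_ifs <;> simp
      _ = ∑ U : OddSet n, ∑ c ∈ C, ∑ M ∈ Y, (if (U, M) ∈ Qset n t c then
            w c / ((Qset n t c).card : ℝ) * zeta q U.1 else 0) := sum_congr rfl fun U _ => sum_comm
      _ = ∑ c ∈ C, ∑ U : OddSet n, ∑ M ∈ Y, (if (U, M) ∈ Qset n t c then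
            w c / ((Qset n t c).card : ℝ) * zeta q U.1 else 0) := sum_comm
      _ = ∑ c ∈ C, w c / ((Qset n t c).card : ℝ) *
            ∑ M ∈ Y, ∑ U : OddSet n, (if U.1.card = t ∧ cc U M = c then zeta q U.1 else 0) := by
          refine sum_congr rfl fun c _ => ?_
          rw [mul_sum, sum_comm]
          refine sum_congr rfl fun M _ => ?_
          rw [mul_sum]
          refine sum_congr rfl fun U _ => ?_
          simp only [mem_Qset_iff]
          split_ifs <;> simp
  -- Step 2: per matching, the polynomial from `containment_comb_poly`
  have hN : ∀ M : PMatch n, M.1.card = n / 2 := fun M => by have := two_mul_card_pmatch M; omega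
  have hP : ∀ M : PMatch n, ∃ P : Polynomial ℝ, P.natDegree ≤ D ∧
      P.eval 0 = ∑ A : {A : Finset (Fin n) // A.card ≤ D},
        q A.1 * knapsackMoment M.1.card ((t : ℝ) / 2) (M.1.filter fun e => ∃ a ∈ A.1, a ∈ e).card ∧
      ∀ c i : ℕ, c + 2 * i = t →
        ∑ U : OddSet n, (if U.1.card = t ∧ cc U M = c then zeta q U.1 else 0) =
          (((n / 2).choose (c + i) * (c + i).choose i * 2 ^ c : ℕ) : ℝ) * P.eval (c : ℝ) := by
    intro M
    obtain ⟨P, hPdeg, hP0, hPval⟩ := containment_comb_poly M t D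
      (σ := {A : Finset (Fin n) // A.card ≤ D}) (fun A => q A.1) (fun A => A.1)
      (fun A => by
        have h1 : (M.1.filter fun e => ∃ a ∈ A.1, a ∈ e).card ≤ A.1.card := by
          convert card_filter_meets_le M.2 A.1 using 3
        exact h1.trans A.2)
    refine ⟨P, hPdeg, hP0, fun c i hci => ?_⟩
    have key := sum_oddSet_level_eq M hci (r := 1) (fun U => zeta q U.1 • (1 : Matrix (Fin 1) (Fin 1) ℝ)) (fun _ => 1)
    simp only [Matrix.trace_smul, Matrix.trace_one, Fintype.card_fin, Nat.cast_one, smul_eq_mul, mul_one] at key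
    rw [key, ← hN M, ← hPval c i hci]
    refine sum_congr rfl fun U' hU' => ?_
    have hodd : Odd U'.card := by
      obtain ⟨-, hc, hi⟩ := mem_filter.1 hU'
      have h := card_eq_cr_add_two_mul_in M.2 (subset_univ U')
      rw [hc, hi, hci] at h
      exact h ▸ htodd
    rw [dif_pos hodd, zeta_eq_sum_subtype q hq U']
  choose P hPdeg hP0 hPval using hP
  -- Step 3: `|Q_c| = #PM · T(n/2; c, i)`
  have hQ : ∀ c i : ℕ, c + 2 * i = t → ((Qset n t c).card : ℝ) =
      (Fintype.card (PMatch n) : ℝ) * (((n / 2).choose (c + i) * (c + i).choose i * 2 ^ c : ℕ) : ℝ) := by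
    intro c i hci
    have e1 : ((Qset n t c).card : ℝ) =
        ∑ M : PMatch n, ∑ U : OddSet n, (if U.1.card = t ∧ cc U M = c then (1 : ℝ) else 0) := by
      rw [Qset, Finset.card_filter, Nat.cast_sum, Fintype.sum_prod_type, sum_comm]
      refine sum_congr rfl fun M _ => sum_congr rfl fun U _ => ?_
      split_ifs <;> simp
    have e2 : ∀ M : PMatch n, ∑ U : OddSet n, (if U.1.card = t ∧ cc U M = c then (1 : ℝ) else 0) =
        (((n / 2).choose (c + i) * (c + i).choose i * 2 ^ c : ℕ) : ℝ) := by
      intro M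
      have key := sum_oddSet_level_eq M hci (r := 1) (fun _ => 1) (fun _ => 1)
      simp only [Matrix.mul_one, trace_one, Fintype.card_fin, Nat.cast_one, dite_eq_ite] at key
      rw [key]
      have hodd : ∀ U' ∈ (univ : Finset (Fin n)).powerset.filter (fun U' =>
          (M.1.filter fun e => cutCount U' e = 1).card = c ∧ (M.1.filter fun e => cutCount U' e = 2).card = i),
          (if Odd U'.card then (1 : ℝ) else 0) = 1 := by
        intro U' hU'
        rw [mem_filter] at hU'
        have hc := card_eq_cr_add_two_mul_in M.2 (subset_univ U')
        rw [hU'.2.1, hU'.2.2, hci] at hc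
        rw [if_pos (hc ▸ htodd)]
      rw [sum_congr rfl hodd, sum_const, nsmul_eq_mul, mul_one, card_filter_cr_in_eq M.2, hN M]
    rw [e1, Fintype.sum_congr _ _ e2, sum_const, card_univ, nsmul_eq_mul]
  -- Step 4: assemble
  rw [hval]
  have hterm : ∀ c ∈ C, w c / ((Qset n t c).card : ℝ) *
      ∑ M ∈ Y, ∑ U : OddSet n, (if U.1.card = t ∧ cc U M = c then zeta q U.1 else 0) =
      (Fintype.card (PMatch n) : ℝ)⁻¹ * ∑ M ∈ Y, w c * (P M).eval (c : ℝ) := by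
    intro c hc
    obtain ⟨hcodd, -, hcT, hne⟩ := hC c hc
    obtain ⟨i, hi⟩ : ∃ i, c + 2 * i = t := by
      obtain ⟨a, ha⟩ := hcodd; obtain ⟨b, hb⟩ := htodd; exact ⟨b - a, by omega⟩
    have hQc := hQ c i hi
    have hQ0 : ((Qset n t c).card : ℝ) ≠ 0 := by exact_mod_cast (card_pos.2 hne).ne'
    have hT0 : (((n / 2).choose (c + i) * (c + i).choose i * 2 ^ c : ℕ) : ℝ) ≠ 0 := by
      intro h0; rw [h0, mul_zero] at hQc; exact hQ0 hQc
    rw [sum_congr rfl fun M _ => hPval M c i hi, ← mul_sum, hQc, mul_sum, mul_sum, mul_sum]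
    refine sum_congr rfl fun M _ => ?_
    field_simp
  rw [sum_congr rfl hterm, ← mul_sum, sum_comm]
  have hinner : ∀ M ∈ Y, ∑ c ∈ C, w c * (P M).eval (c : ℝ) = -(P M).eval 0 :=
    fun M _ => hexact (P M) (hPdeg M)
  rw [sum_congr rfl hinner, sum_neg_distrib, mul_neg]
  congr 1
  congr 1
  exact sum_congr rfl fun M _ => hP0 M

end Summit.PneNP.PneNP.Theorems.ChebyshevTracialDesignLowDegreePricing
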